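import Summits.CriticalPhenomena.PercolationContinuityZ3.Theorems.PercNearOneGluingNoHeavyLowerTailCILOwnEdgeStability
import Summits.CriticalPhenomena.PercolationContinuityZ3.Theorems.PercNearOneGluingNoHeavyLowerTailCILRelayGluing
import HarnessLib

/-!
# `NoHeavyLowerTail` (stmt-CriticalPhenomena-4575) — CIL for a relay-neighboured observer with ONE PORT ADDED:
# the champion of the graph WITHOUT that port is still a valid witness ("port-addition stability")

Support file (prover `prim-lf-3`, lemma factory #3; `--supports stmt-CriticalPhenomena-4575`).  No definitions, no named facts,
no sorries.

Notation: `μ_w = prodBernoulli w` on `Fin n`, relays `A`, level `j`, `π(v) = {z ∈ A : v ↔ z}`, lightness `I_w(x) = μ_w{|π(x)| ≤ j}`,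
`L_w(y) = μ_w{1 ≤ |π(y)| ≤ j}` for a non-relay observer `y`; a CHAMPION of `w` is a relay maximising `I_w` over `A`.

**Theorem (`cil_of_portAddition`).**  Let `y ∉ A` be relay-neighboured (every positive-weight neighbour of `y` is a relay), let
`a ∈ A`, `e = s(a, y)`, and let `c ∈ A`, `c ≠ a`, be a champion of the graph `w[e ↦ 0]` in which the port `a` of `y` is removed.
Then `c` is a valid CIL witness for `y` in `w` ITSELF, whatever the weight of `e`:  `L_w(y) ≤ I_w(c)`.

So the champion of the reference `w − e` (one port-edge of the observer deleted) is a sound witness, in addition to the champions of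
`w` (`cil_of_portDomination`) and the best port in `w − y` (`cil_relayNeighbours_port`); numerically most deeper references are NOT sound
(crux evidence LEAD-GEN1 'reference-robustness map').  Proof: both sides are affine in the weight of `e`
(`stub_oneBondDecomp_k15`); at weight `0` this is `cil_champion_of_relayNeighbours`; at weight `1` the observer is glued to the relay `a`,
so `L ≤ I(a)` pointwise (`ChampionStability.real_update_one_eq`), and `I(a) ≤ I(c)` survives raising a pair AT `a` by own-edge stability in the
form `CutObserver.lightness_sub_ge_of_erase_edge` (van den Berg–Häggström–Kahn 2006 Thm 1.5 underneath).

Role (crux memo LF3-RNCS.md §5, item evidence): this is the `|P_x| = 1` case ("pendant arm") of set-champion stability for a relay-neighboured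
Steiner PAIR `{x, y}` (RN-CS(2)), the atom to which CIL for observers with two relay-neighbourly Steiner arms reduces.
-/

noncomputable section

namespace Summit.CriticalPhenomena.PercolationContinuityZ3.Theorems

open MeasureTheory Set Literature.Probability.LatticeModels Literature.Probability.Percolation
open scoped Classical BigOperators

variable {n : ℕ}

/-- **Port-addition stability of the champion witness.**  `y ∉ A` relay-neighboured, `a ∈ A`, `c ∈ A`, `c ≠ a`, and `c` a
champion of `w[s(a,y) ↦ 0]`; then `μ_w{1 ≤ |π(y)| ≤ j} ≤ μ_w{|π(c)| ≤ j}`. [this file] -/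
theorem cil_of_portAddition (w : Sym2 (Fin n) → unitInterval) (A : Finset (Fin n)) (y a c : Fin n) (j : ℕ)
    (hy : y ∉ A) (ha : a ∈ A) (hc : c ∈ A) (hca : c ≠ a)
    (hrelay : ∀ v : Fin n, v ≠ y → v ∉ A → (w s(y, v) : ℝ) = 0)
    (hchamp : ∀ b ∈ A,
      (prodBernoulli (Function.update w s(a, y) 0)).real
          {ω : BondConfig (Fin n) | (A.filter fun x => ω ∈ openConn b x).card ≤ j} ≤
        (prodBernoulli (Function.update w s(a, y) 0)).real
          {ω : BondConfig (Fin n) | (A.filter fun x => ω ∈ openConn c x).card ≤ j}) :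
    (prodBernoulli w).real {ω : BondConfig (Fin n) |
        1 ≤ (A.filter fun x => ω ∈ openConn y x).card ∧ (A.filter fun x => ω ∈ openConn y x).card ≤ j} ≤
      (prodBernoulli w).real {ω : BondConfig (Fin n) | (A.filter fun x => ω ∈ openConn c x).card ≤ j} := by
  set e : Sym2 (Fin n) := s(a, y) with he
  set w₀ := Function.update w e 0 with hw₀
  set w₁ := Function.update w e 1 with hw₁
  set L : Set (BondConfig (Fin n)) := {ω : BondConfig (Fin n) |
    1 ≤ (A.filter fun x => ω ∈ openConn y x).card ∧ (A.filter fun x => ω ∈ openConn y x).card ≤ j} with hL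
  set Rc : Set (BondConfig (Fin n)) := {ω : BondConfig (Fin n) | (A.filter fun x => ω ∈ openConn c x).card ≤ j}
    with hRc
  set Ra : Set (BondConfig (Fin n)) := {ω : BondConfig (Fin n) | (A.filter fun x => ω ∈ openConn a x).card ≤ j}
    with hRa
  have hay : a ≠ y := fun h => hy (h ▸ ha)
  -- weight 0: `y` is relay-neighboured in `w₀` and `c` is a champion of `w₀`
  have h0 : (prodBernoulli w₀).real L ≤ (prodBernoulli w₀).real Rc := by
    have hrelay0 : ∀ v : Fin n, v ≠ y → v ∉ A → (w₀ s(y, v) : ℝ) = 0 := by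
      intro v hv hvA
      by_cases hve : s(y, v) = e
      · rw [hve, hw₀, Function.update_self]; rfl
      · rw [hw₀, Function.update_of_ne hve]; exact hrelay v hv hvA
    exact CILOneSteiner.cil_champion_of_relayNeighbours A y j hy _ w₀ rfl hrelay0 c hc hchamp
  -- weight 1, step 1: `c` stays ahead of `a` after raising the pair `e` at `a`
  have h1c : (prodBernoulli w₁).real Ra ≤ (prodBernoulli w₁).real Rc := by
    have hupd : Function.update w₁ s(a, y) 0 = w₀ := by
      rw [hw₁, hw₀, ← he, Function.update_idem]
    have key := CutObserver.lightness_sub_ge_of_erase_edge w₁ A a y c j hay hca (by rw [hupd]; exact hchamp a ha)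
    have hwe : (w₁ s(a, y) : ℝ) = 1 := by rw [← he, hw₁, Function.update_self]; rfl
    rw [hwe, sub_self, zero_mul] at key
    linarith
  -- weight 1, step 2: under `w₁` the observer is glued to `a`, so `L ≤ I(a)`
  have h1L : (prodBernoulli w₁).real L ≤ (prodBernoulli w₁).real Ra := by
    have hw0e : w₀ s(a, y) = 0 := by rw [← he, hw₀, Function.update_self]
    have hw1' : w₁ = Function.update w₀ s(a, y) 1 := by rw [hw₁, hw₀, ← he, Function.update_idem]
    rw [hw1', ChampionStability.real_update_one_eq w₀ hw0e L, ChampionStability.real_update_one_eq w₀ hw0e Ra]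
    apply measureReal_mono _ (measure_ne_top _ _)
    intro ω hω
    simp only [Set.mem_preimage, hL, hRa, Set.mem_setOf_eq] at hω ⊢
    have hadj : (openGraph (insert s(a, y) ω)).Reachable a y :=
      SimpleGraph.Adj.reachable ((openGraph_adj _ a y).2 ⟨Set.mem_insert _ _, hay⟩)
    have hfilt : (A.filter fun x => insert s(a, y) ω ∈ openConn a x) =
        (A.filter fun x => insert s(a, y) ω ∈ openConn y x) := by
      apply Finset.filter_congr
      intro x _
      simp only [openConn, Set.mem_setOf_eq]
      exact ⟨fun h => hadj.symm.trans h, fun h => hadj.trans h⟩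
    rw [hfilt]
    exact hω.2
  -- affine combination
  have hp0 : 0 ≤ (w e : ℝ) := (w e).2.1
  have hp1 : (w e : ℝ) ≤ 1 := (w e).2.2
  rw [stub_oneBondDecomp_k15 n w e L, stub_oneBondDecomp_k15 n w e Rc]
  have hA : (1 - (w e : ℝ)) * (prodBernoulli w₀).real L ≤ (1 - (w e : ℝ)) * (prodBernoulli w₀).real Rc :=
    mul_le_mul_of_nonneg_left h0 (by linarith)
  have hB : (w e : ℝ) * (prodBernoulli w₁).real L ≤ (w e : ℝ) * (prodBernoulli w₁).real Rc :=
    mul_le_mul_of_nonneg_left (h1L.trans h1c) hp0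
  linarith

/-- **Port addition for an arbitrary observer and an arbitrary valid witness.**  Let `y ∉ A`, `a ∈ A`, `c ∈ A`, `c ≠ a`,
`e = s(a, y)`, `w₀ = w[e ↦ 0]`.  If `c` is a valid CIL witness for `y` under `w₀` (`μ_{w₀}{1 ≤ |π(y)| ≤ j} ≤ μ_{w₀}{|π(c)| ≤ j}`) and
`c` is at least as light as `a` under `w₀`, then `c` is a valid witness for `y` under `w`, whatever the weight of `e` (no assumption on the
other neighbours of `y`).  Both sides are affine in the weight of `e`; at weight `1` the observer is glued to `a` and
`CutObserver.lightness_glued_le` carries `I(a) ≤ I(c)` over. [this file] -/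
theorem cil_witness_of_portAddition (w : Sym2 (Fin n) → unitInterval) (A : Finset (Fin n)) (y a c : Fin n) (j : ℕ)
    (hy : y ∉ A) (ha : a ∈ A) (hca : c ≠ a)
    (hvalid : (prodBernoulli (Function.update w s(a, y) 0)).real {ω : BondConfig (Fin n) |
        1 ≤ (A.filter fun x => ω ∈ openConn y x).card ∧ (A.filter fun x => ω ∈ openConn y x).card ≤ j} ≤
      (prodBernoulli (Function.update w s(a, y) 0)).real
        {ω : BondConfig (Fin n) | (A.filter fun x => ω ∈ openConn c x).card ≤ j})
    (hac : (prodBernoulli (Function.update w s(a, y) 0)).real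
          {ω : BondConfig (Fin n) | (A.filter fun x => ω ∈ openConn a x).card ≤ j} ≤
        (prodBernoulli (Function.update w s(a, y) 0)).real
          {ω : BondConfig (Fin n) | (A.filter fun x => ω ∈ openConn c x).card ≤ j}) :
    (prodBernoulli w).real {ω : BondConfig (Fin n) |
        1 ≤ (A.filter fun x => ω ∈ openConn y x).card ∧ (A.filter fun x => ω ∈ openConn y x).card ≤ j} ≤
      (prodBernoulli w).real {ω : BondConfig (Fin n) | (A.filter fun x => ω ∈ openConn c x).card ≤ j} := by
  set e : Sym2 (Fin n) := s(a, y) with he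
  set w₀ := Function.update w e 0 with hw₀
  set w₁ := Function.update w e 1 with hw₁
  set L : Set (BondConfig (Fin n)) := {ω : BondConfig (Fin n) |
    1 ≤ (A.filter fun x => ω ∈ openConn y x).card ∧ (A.filter fun x => ω ∈ openConn y x).card ≤ j} with hL
  set Rc : Set (BondConfig (Fin n)) := {ω : BondConfig (Fin n) | (A.filter fun x => ω ∈ openConn c x).card ≤ j}
    with hRc
  set Ra : Set (BondConfig (Fin n)) := {ω : BondConfig (Fin n) | (A.filter fun x => ω ∈ openConn a x).card ≤ j}
    with hRa
  have hay : a ≠ y := fun h => hy (h ▸ ha)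
  have h1c : (prodBernoulli w₁).real Ra ≤ (prodBernoulli w₁).real Rc := by
    have hw0e : w₀ s(a, y) = 0 := by rw [← he, hw₀, Function.update_self]
    have hw1' : w₁ = Function.update w₀ s(a, y) 1 := by rw [hw₁, hw₀, ← he, Function.update_idem]
    rw [hw1']
    exact CutObserver.lightness_glued_le w₀ A a y c j hay hca hw0e hac
  have h1L : (prodBernoulli w₁).real L ≤ (prodBernoulli w₁).real Ra := by
    have hw0e : w₀ s(a, y) = 0 := by rw [← he, hw₀, Function.update_self]
    have hw1' : w₁ = Function.update w₀ s(a, y) 1 := by rw [hw₁, hw₀, ← he, Function.update_idem]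
    rw [hw1', ChampionStability.real_update_one_eq w₀ hw0e L, ChampionStability.real_update_one_eq w₀ hw0e Ra]
    apply measureReal_mono _ (measure_ne_top _ _)
    intro ω hω
    simp only [Set.mem_preimage, hL, hRa, Set.mem_setOf_eq] at hω ⊢
    have hadj : (openGraph (insert s(a, y) ω)).Reachable a y :=
      SimpleGraph.Adj.reachable ((openGraph_adj _ a y).2 ⟨Set.mem_insert _ _, hay⟩)
    have hfilt : (A.filter fun x => insert s(a, y) ω ∈ openConn a x) =
        (A.filter fun x => insert s(a, y) ω ∈ openConn y x) := by
      apply Finset.filter_congr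
      intro x _
      simp only [openConn, Set.mem_setOf_eq]
      exact ⟨fun h => hadj.symm.trans h, fun h => hadj.trans h⟩
    rw [hfilt]
    exact hω.2
  have hp0 : 0 ≤ (w e : ℝ) := (w e).2.1
  have hp1 : (w e : ℝ) ≤ 1 := (w e).2.2
  rw [stub_oneBondDecomp_k15 n w e L, stub_oneBondDecomp_k15 n w e Rc]
  have hA : (1 - (w e : ℝ)) * (prodBernoulli w₀).real L ≤ (1 - (w e : ℝ)) * (prodBernoulli w₀).real Rc :=
    mul_le_mul_of_nonneg_left hvalid (by linarith)
  have hB : (w e : ℝ) * (prodBernoulli w₁).real L ≤ (w e : ℝ) * (prodBernoulli w₁).real Rc :=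
    mul_le_mul_of_nonneg_left (h1L.trans h1c) hp0
  linarith

end Summit.CriticalPhenomena.PercolationContinuityZ3.Theorems

end
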